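import Summits.NavierStokesRegularity.OSWSelfSimilar.SheetNSLineTorusCascade
import HarnessLib

/-!
# Viscous CLM on the torus (`a = 0`, `σ = 2`): the Wiener-norm threshold `2ν` for nonnegative-coefficient data
# (partial sums of the cascade obey the Riccati inequality `Ṡ ≤ ½ S² − ν S`)

HONEST FRAMING (cell ns-blowup GROUP B «PROFILE SEARCH», zone Z3, row Z3-U addendum A-F2 of `HOME/profile/z3/CENSUS-Z3.md`;
human rulings D-0035/D-0074): **1-D MODEL (viscous Constantin–Lax–Majda equation `ω_t = ω Hω + ν ω_xx` on `𝕋 = ℝ/2πℤ`);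
ODE calculus on Fourier-coefficient families, kernel-checked; not Euler, not Navier–Stokes; «violates: none — MODEL».**

OBJECT. The cascade `ċ_k = ½ Σ_{i+j=k} c_i c_j − ν k² c_k` (`c_0 ≡ 0`) of the analytic signal `z = Hω − iω = Σ_{k≥1} c_k e^{ikx}`
(companion files `SheetNSLineTorusCascade`, `SheetNSLineTorusCascadeGlobal`), now for an ARBITRARY datum with nonnegative real
coefficients `c_k(0) ≥ 0` (`IsNonnegCascade`; e.g. `ω₀ = −Σ_k a_k sin kx`, `a_k ≥ 0`; the sine datum is the case `a_1 = c`).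
All modes stay `≥ 0` (`nonneg`), and the Galerkin partial sums `S_K(t) = Σ_{k≤K} c_k(t)` — truncation is EXACT downwards for a
triangular system — satisfy `Ṡ_K ≤ ½ S_K² − ν S_K` (`Σ_{k≤K} Σ_{i+j=k} c_i c_j ≤ S_K²`, `sum_conv_le_sq`; `k² ≥ 1`). The Bernoulli
substitution `y = e^{νt} S_K`, `φ = 1/y − e^{−νt}/(2ν)` non-decreasing, gives

* `partialSum_le_riccati` — **if `S_K(0) < 2ν` (and the first mode is present) then for all `t ≥ 0`:
  `S_K(t) ≤ 2ν S_K(0) / ((2ν − S_K(0)) e^{νt} + S_K(0))`**, the solution of `ẏ = ½y² − νy` from `S_K(0)`;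
* `partialSum_le_of_wiener` — **if every `S_K(0) ≤ W < 2ν` (i.e. `‖ω₀‖_{B₀} = Σ_k c_k(0) ≤ W < 2ν`) then
  `S_K(t) ≤ (2νW/(2ν − W))·e^{−νt}` for all `K`, `t ≥ 0`** — a uniform Wiener-norm (`B₀`) a-priori bound decaying at the rate of the
  first mode, hence (pen: standard `B₀` continuation criterion [cite: AmbroseLushnikovSiegelSilantyev2024, §3]) a GLOBAL decaying
  solution. Print: global existence for `‖ω₀‖_{B₀} < ν/4` at any `σ > 0` [cite: SilantyevLushnikovSiegelAmbrose2025, Thm 2.2];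
  the triangular structure gives `2ν` at `σ = 2` in this sign class (and `2eν` for the pure sine datum, companion file).
bears_on: LADDER-NS N5 / zone Z3 (row Z3-U) → N1 linear core. WHAT THIS IS NOT: not NS; nonnegative real analytic-signal
coefficients only (general complex data need the majorant `|c_k| ≤ C_k`, not typed here); no PDE object; not the threshold value.
-/

namespace Summit.NavierStokesRegularity.OSWSelfSimilar
namespace SheetNSLineTorusCascade

open Finset Real Set

/-- **The nonnegative-datum cascade**: as `IsSineCascade` but with an arbitrary datum `c_k(0) ≥ 0` (`k ≥ 1`), `c_0 ≡ 0`.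
[new here — MODEL] -/
structure IsNonnegCascade (ν : ℝ) (e : ℕ → ℝ → ℝ) : Prop where
  /-- mode `0` vanishes identically (mean-zero class) -/
  zero : ∀ t, e 0 t = 0
  /-- every mode is continuous on `[0, ∞)` -/
  cont : ∀ k, ContinuousOn (e k) (Ici 0)
  /-- the cascade (C) for `t > 0` -/
  ode : ∀ k : ℕ, ∀ t : ℝ, 0 < t →
    HasDerivAt (e k) ((1 / 2) * (∑ p ∈ antidiagonal k, e p.1 t * e p.2 t) - ν * (k : ℝ) ^ 2 * e k t) t
  /-- nonnegative datum -/
  init_nonneg : ∀ k, 0 ≤ e k 0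

variable {ν c : ℝ} {e : ℕ → ℝ → ℝ}

/-- The sine datum with `c ≥ 0` is a nonnegative datum. -/
theorem IsSineCascade.isNonnegCascade (he : IsSineCascade ν c e) (hc : 0 ≤ c) : IsNonnegCascade ν e where
  zero := he.zero
  cont := he.cont
  ode := he.ode
  init_nonneg k := by
    rcases Nat.lt_or_ge k 2 with hk | hk
    · interval_cases k
      · rw [he.zero]
      · rw [he.one_init]; exact hc
    · rw [he.init_zero k hk]

namespace IsNonnegCascade

/-- The weighted mode `e^{νk²t} c_k(t)` has derivative `e^{νk²t}·½ Σ_{i+j=k} c_i c_j` (`t > 0`). -/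
theorem hasDerivAt_weighted (he : IsNonnegCascade ν e) (k : ℕ) {t : ℝ} (ht : 0 < t) :
    HasDerivAt (fun s => exp (ν * (k : ℝ) ^ 2 * s) * e k s)
      (exp (ν * (k : ℝ) ^ 2 * t) * ((1 / 2) * ∑ p ∈ antidiagonal k, e p.1 t * e p.2 t)) t := by
  have h1 : HasDerivAt (fun s => exp (ν * (k : ℝ) ^ 2 * s)) (exp (ν * (k : ℝ) ^ 2 * t) * (ν * (k : ℝ) ^ 2)) t := by
    have := ((hasDerivAt_id t).const_mul (ν * (k : ℝ) ^ 2)).exp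
    simpa using this
  refine (h1.mul (he.ode k t ht)).congr_deriv ?_
  ring

/-- **All modes stay nonnegative** (strong induction: `e^{νk²t} c_k` is non-decreasing). [new here — MODEL] -/
theorem nonneg (he : IsNonnegCascade ν e) : ∀ k : ℕ, ∀ t : ℝ, 0 ≤ t → 0 ≤ e k t := by
  intro k
  induction k using Nat.strong_induction_on with
  | _ k ih =>
    intro t ht
    have hmono : MonotoneOn (fun s => exp (ν * (k : ℝ) ^ 2 * s) * e k s) (Ici 0) := by
      refine monotoneOn_of_hasDerivWithinAt_nonneg
        (f' := fun s => exp (ν * (k : ℝ) ^ 2 * s) * ((1 / 2) * ∑ p ∈ antidiagonal k, e p.1 s * e p.2 s))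
        (convex_Ici 0) (((continuous_exp.comp (continuous_const.mul continuous_id)).continuousOn).mul (he.cont k))
        (fun s hs => ?_) (fun s hs => ?_)
      · rw [interior_Ici] at hs ⊢
        exact (hasDerivAt_weighted he k hs).hasDerivWithinAt
      · rw [interior_Ici] at hs
        refine mul_nonneg (exp_pos _).le (mul_nonneg (by norm_num) (sum_nonneg fun p hp => ?_))
        have hsum : p.1 + p.2 = k := mem_antidiagonal.mp hp
        rcases Nat.eq_zero_or_pos p.1 with h1 | h1
        · rw [h1, he.zero, zero_mul]
        rcases Nat.eq_zero_or_pos p.2 with h2 | h2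
        · rw [h2, he.zero, mul_zero]
        exact mul_nonneg (ih p.1 (by omega) s (le_of_lt hs)) (ih p.2 (by omega) s (le_of_lt hs))
    have h0 : 0 ≤ exp (ν * (k : ℝ) ^ 2 * 0) * e k 0 := mul_nonneg (exp_pos _).le (he.init_nonneg k)
    have hD : 0 ≤ exp (ν * (k : ℝ) ^ 2 * t) * e k t := le_trans h0 (hmono (self_mem_Ici) ht ht)
    exact (mul_nonneg_iff_of_pos_left (exp_pos _)).mp hD

/-- A mode present in the datum stays positive: `c_k(t) ≥ c_k(0) e^{−νk²t}`. [new here — MODEL] -/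
theorem init_mul_exp_le (he : IsNonnegCascade ν e) (k : ℕ) (t : ℝ) (ht : 0 ≤ t) :
    e k 0 * exp (-(ν * (k : ℝ) ^ 2 * t)) ≤ e k t := by
  have hmono : MonotoneOn (fun s => exp (ν * (k : ℝ) ^ 2 * s) * e k s) (Ici 0) := by
    refine monotoneOn_of_hasDerivWithinAt_nonneg
      (f' := fun s => exp (ν * (k : ℝ) ^ 2 * s) * ((1 / 2) * ∑ p ∈ antidiagonal k, e p.1 s * e p.2 s))
      (convex_Ici 0) (((continuous_exp.comp (continuous_const.mul continuous_id)).continuousOn).mul (he.cont k))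
      (fun s hs => ?_) (fun s hs => ?_)
    · rw [interior_Ici] at hs ⊢
      exact (hasDerivAt_weighted he k hs).hasDerivWithinAt
    · rw [interior_Ici] at hs
      refine mul_nonneg (exp_pos _).le (mul_nonneg (by norm_num) (sum_nonneg fun p _ => ?_))
      exact mul_nonneg (he.nonneg p.1 s hs.le) (he.nonneg p.2 s hs.le)
  have h := hmono (self_mem_Ici) ht ht
  simp only [mul_zero, exp_zero, one_mul] at h
  have hexp : exp (ν * (k : ℝ) ^ 2 * t) * exp (-(ν * (k : ℝ) ^ 2 * t)) = 1 := by rw [← exp_add]; simp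
  calc e k 0 * exp (-(ν * (k : ℝ) ^ 2 * t))
      ≤ (exp (ν * (k : ℝ) ^ 2 * t) * e k t) * exp (-(ν * (k : ℝ) ^ 2 * t)) :=
        mul_le_mul_of_nonneg_right h (exp_pos _).le
    _ = e k t := by
        rw [mul_comm (exp _) (e k t), mul_assoc, hexp, mul_one]

/-- **The Cauchy-product partial sums are dominated by the square of the partial sum** (nonnegative terms):
`Σ_{k ≤ K} Σ_{i+j=k} c_i c_j ≤ (Σ_{k ≤ K} c_k)²`. [folklore] -/
theorem sum_conv_le_sq {f : ℕ → ℝ} (hf : ∀ k, 0 ≤ f k) (K : ℕ) :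
    ∑ k ∈ range (K + 1), ∑ p ∈ antidiagonal k, f p.1 * f p.2
      ≤ (∑ k ∈ range (K + 1), f k) ^ 2 := by
  have hdisj : (↑(range (K + 1)) : Set ℕ).PairwiseDisjoint antidiagonal := by
    intro a _ b _ hab
    refine disjoint_left.mpr fun p hpa hpb => hab ?_
    have ha := HasAntidiagonal.mem_antidiagonal.mp hpa
    have hb := HasAntidiagonal.mem_antidiagonal.mp hpb
    omega
  rw [← sum_biUnion hdisj, sq, sum_mul_sum, ← sum_product']
  refine sum_le_sum_of_subset_of_nonneg ?_ (fun p _ _ => mul_nonneg (hf _) (hf _))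
  intro p hp
  obtain ⟨k, hk, hpk⟩ := mem_biUnion.mp hp
  have hpk' := HasAntidiagonal.mem_antidiagonal.mp hpk
  have hk' := Finset.mem_range.mp hk
  rw [Finset.mem_product, Finset.mem_range, Finset.mem_range]
  omega

/-- The right-hand side of the cascade, summed over `k ≤ K`, is at most `½ S_K² − ν S_K` (`k² ≥ 1` on the modes `k ≥ 1`;
mode `0` vanishes). [new here — MODEL] -/
theorem sum_rhs_le (he : IsNonnegCascade ν e) (hν : 0 ≤ ν) (K : ℕ) (t : ℝ) (ht : 0 ≤ t) :
    ∑ k ∈ range (K + 1), ((1 / 2) * (∑ p ∈ antidiagonal k, e p.1 t * e p.2 t) - ν * (k : ℝ) ^ 2 * e k t)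
      ≤ (1 / 2) * (∑ k ∈ range (K + 1), e k t) ^ 2 - ν * ∑ k ∈ range (K + 1), e k t := by
  rw [sum_sub_distrib, ← mul_sum, mul_sum (range (K + 1)) (fun k => e k t) ν]
  have h1 := sum_conv_le_sq (fun k => he.nonneg k t ht) K
  have h2 : ∑ k ∈ range (K + 1), ν * e k t ≤ ∑ k ∈ range (K + 1), ν * (k : ℝ) ^ 2 * e k t := by
    refine sum_le_sum fun k _ => ?_
    rcases Nat.eq_zero_or_pos k with hk | hk
    · rw [hk, he.zero]; simp
    · have hk1 : (1 : ℝ) ≤ (k : ℝ) ^ 2 := by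
        have : (1 : ℝ) ≤ k := by exact_mod_cast hk
        nlinarith
      have := he.nonneg k t ht
      nlinarith [mul_nonneg hν this]
  linarith

/-- **THE RICCATI BOUND.** For a nonnegative datum whose first mode is present (`c_1(0) > 0`) and `ν > 0`: if
`S_K(0) = Σ_{k≤K} c_k(0) < 2ν` then for all `t ≥ 0`, `S_K(t) ≤ 2ν S_K(0)/((2ν − S_K(0)) e^{νt} + S_K(0))` — the solution
of the Riccati equation `ẏ = ½y² − νy` from `S_K(0)`. [new here — MODEL] -/
theorem partialSum_le_riccati (he : IsNonnegCascade ν e) (hν : 0 < ν) (h1 : 0 < e 1 0) (K : ℕ) (hK : 1 ≤ K)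
    (hS : ∑ k ∈ range (K + 1), e k 0 < 2 * ν) (t : ℝ) (ht : 0 ≤ t) :
    ∑ k ∈ range (K + 1), e k t
      ≤ 2 * ν * (∑ k ∈ range (K + 1), e k 0)
          / ((2 * ν - ∑ k ∈ range (K + 1), e k 0) * exp (ν * t) + ∑ k ∈ range (K + 1), e k 0) := by
  set S : ℝ → ℝ := fun s => ∑ k ∈ range (K + 1), e k s with hSdef
  set S₀ : ℝ := ∑ k ∈ range (K + 1), e k 0 with hS₀
  -- S > 0 on [0, ∞) (the first mode is present)
  have hSpos : ∀ s, 0 ≤ s → 0 < S s := by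
    intro s hs
    have hle : e 1 s ≤ S s := by
      show e 1 s ≤ ∑ k ∈ range (K + 1), e k s
      exact single_le_sum (f := fun k => e k s) (fun k _ => he.nonneg k s hs) (mem_range.mpr (by omega))
    have h1s : 0 < e 1 s := by
      have := he.init_mul_exp_le 1 s hs
      have hpos : 0 < e 1 0 * exp (-(ν * ((1 : ℕ) : ℝ) ^ 2 * s)) := mul_pos h1 (exp_pos _)
      linarith
    linarith
  have hS₀pos : 0 < S₀ := hSpos 0 le_rfl
  -- derivative of S on t > 0 and the Riccati inequality
  have hS' : ∀ s, 0 < s → HasDerivAt S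
      (∑ k ∈ range (K + 1), ((1 / 2) * (∑ p ∈ antidiagonal k, e p.1 s * e p.2 s) - ν * (k : ℝ) ^ 2 * e k s)) s := by
    intro s hs
    exact HasDerivAt.fun_sum fun k _ => he.ode k s hs
  have hScont : ContinuousOn S (Ici 0) := continuousOn_finsetSum _ fun k _ => he.cont k
  -- y = e^{νt} S, φ = 1/y − e^{−νt}/(2ν) is non-decreasing on [0, ∞)
  set y : ℝ → ℝ := fun s => exp (ν * s) * S s with hy
  have hypos : ∀ s, 0 ≤ s → 0 < y s := fun s hs => mul_pos (exp_pos _) (hSpos s hs)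
  have hy' : ∀ s, 0 < s → HasDerivAt y (exp (ν * s) * ν * S s + exp (ν * s) *
      (∑ k ∈ range (K + 1), ((1 / 2) * (∑ p ∈ antidiagonal k, e p.1 s * e p.2 s) - ν * (k : ℝ) ^ 2 * e k s))) s := by
    intro s hs
    have h1 : HasDerivAt (fun s => exp (ν * s)) (exp (ν * s) * ν) s := by
      have := ((hasDerivAt_id s).const_mul ν).exp
      simpa using this
    exact h1.mul (hS' s hs)
  have hφmono : MonotoneOn (fun s => (y s)⁻¹ - exp (-(ν * s)) / (2 * ν)) (Ici 0) := by
    refine monotoneOn_of_hasDerivWithinAt_nonneg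
      (f' := fun s => -(exp (ν * s) * ν * S s + exp (ν * s) *
          (∑ k ∈ range (K + 1), ((1 / 2) * (∑ p ∈ antidiagonal k, e p.1 s * e p.2 s) - ν * (k : ℝ) ^ 2 * e k s)))
            / (y s) ^ 2 - (exp (-(ν * s)) * (-ν)) / (2 * ν))
      (convex_Ici 0) ?_ (fun s hs => ?_) (fun s hs => ?_)
    · refine ContinuousOn.sub ?_ ?_
      · refine ContinuousOn.inv₀ ?_ (fun s hs => (hypos s hs).ne')
        exact ((continuous_exp.comp (continuous_const.mul continuous_id)).continuousOn).mul hScont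
      · exact ((continuous_exp.comp ((continuous_const.mul continuous_id).neg)).div_const _).continuousOn
    · rw [interior_Ici] at hs ⊢
      have h1 := (hy' s hs).inv (hypos s hs.le).ne'
      have h2 : HasDerivAt (fun s => exp (-(ν * s)) / (2 * ν)) ((exp (-(ν * s)) * (-ν)) / (2 * ν)) s := by
        have := (((hasDerivAt_id s).const_mul ν).neg.exp).div_const (2 * ν)
        simpa using this
      exact (h1.sub h2).hasDerivWithinAt
    · rw [interior_Ici] at hs
      have hs0 : 0 ≤ s := hs.le
      have hyp := hypos s hs0
      have hrhs := sum_rhs_le he hν.le K s hs0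
      -- y' ≤ ½ e^{−νs} y² :
      have hE : 0 < exp (ν * s) := exp_pos _
      have hy'le : exp (ν * s) * ν * S s + exp (ν * s) *
          (∑ k ∈ range (K + 1), ((1 / 2) * (∑ p ∈ antidiagonal k, e p.1 s * e p.2 s) - ν * (k : ℝ) ^ 2 * e k s))
          ≤ (1 / 2) * exp (-(ν * s)) * (y s) ^ 2 := by
        have := mul_le_mul_of_nonneg_left hrhs hE.le
        have hid : (1 / 2) * exp (-(ν * s)) * (y s) ^ 2 = exp (ν * s) * ((1 / 2) * (S s) ^ 2) := by
          show (1 / 2) * exp (-(ν * s)) * (exp (ν * s) * S s) ^ 2 = exp (ν * s) * ((1 / 2) * (S s) ^ 2)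
          have hee : exp (-(ν * s)) * exp (ν * s) = 1 := by rw [← exp_add]; simp
          calc (1 / 2) * exp (-(ν * s)) * (exp (ν * s) * S s) ^ 2
              = (1 / 2) * (exp (-(ν * s)) * exp (ν * s)) * exp (ν * s) * (S s) ^ 2 := by ring
            _ = exp (ν * s) * ((1 / 2) * (S s) ^ 2) := by rw [hee]; ring
        rw [hid]
        have : exp (ν * s) * ν * S s + exp (ν * s) *
            (∑ k ∈ range (K + 1), ((1 / 2) * (∑ p ∈ antidiagonal k, e p.1 s * e p.2 s) - ν * (k : ℝ) ^ 2 * e k s))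
            ≤ exp (ν * s) * ν * S s + exp (ν * s) * ((1 / 2) * (S s) ^ 2 - ν * S s) := by linarith
        linarith
      -- hence φ' = −y'/y² + ν e^{−νs}/(2ν) ≥ 0
      have hν0 : ν ≠ 0 := hν.ne'
      have hterm : (exp (-(ν * s)) * (-ν)) / (2 * ν) = -((1 / 2) * exp (-(ν * s))) := by
        field_simp
      rw [hterm, sub_neg_eq_add, neg_div]
      have hdiv : (exp (ν * s) * ν * S s + exp (ν * s) *
          (∑ k ∈ range (K + 1), ((1 / 2) * (∑ p ∈ antidiagonal k, e p.1 s * e p.2 s) - ν * (k : ℝ) ^ 2 * e k s)))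
            / (y s) ^ 2 ≤ (1 / 2) * exp (-(ν * s)) := by
        rw [div_le_iff₀ (by positivity)]
        exact hy'le
      linarith
  -- integrate: φ(t) ≥ φ(0)
  have hφ := hφmono (self_mem_Ici) ht ht
  simp only [mul_zero, neg_zero, exp_zero] at hφ
  -- φ(0) = 1/S₀ − 1/(2ν); so 1/y(t) ≥ 1/S₀ − (1 − e^{−νt})/(2ν) =: M > 0
  have hy0 : y 0 = S₀ := by simp [hy, hSdef, hS₀]
  rw [hy0] at hφ
  have hν2 : 0 < 2 * ν := by linarith
  have hM : 0 < S₀⁻¹ - 1 / (2 * ν) + exp (-(ν * t)) / (2 * ν) := by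
    have h1 : 1 / (2 * ν) < S₀⁻¹ := by
      rw [one_div, inv_lt_inv₀ hν2 hS₀pos]; exact hS
    have h2 : 0 ≤ exp (-(ν * t)) / (2 * ν) := by positivity
    linarith
  have hinv : S₀⁻¹ - 1 / (2 * ν) + exp (-(ν * t)) / (2 * ν) ≤ (y t)⁻¹ := by linarith
  -- y t ≤ 1/M
  have hyt : y t ≤ (S₀⁻¹ - 1 / (2 * ν) + exp (-(ν * t)) / (2 * ν))⁻¹ := by
    have := inv_anti₀ hM hinv
    rwa [inv_inv] at this
  -- translate to S t
  have hSt : S t = exp (-(ν * t)) * y t := by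
    show S t = exp (-(ν * t)) * (exp (ν * t) * S t)
    rw [← mul_assoc, ← exp_add]; simp
  show S t ≤ 2 * ν * S₀ / ((2 * ν - S₀) * exp (ν * t) + S₀)
  rw [hSt]
  have hD : 0 < (2 * ν - S₀) * exp (ν * t) + S₀ := by
    have : 0 < 2 * ν - S₀ := by linarith
    positivity
  have htarget : exp (-(ν * t)) * (S₀⁻¹ - 1 / (2 * ν) + exp (-(ν * t)) / (2 * ν))⁻¹
      = 2 * ν * S₀ / ((2 * ν - S₀) * exp (ν * t) + S₀) := by
    have hee : exp (-(ν * t)) = (exp (ν * t))⁻¹ := exp_neg _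
    rw [hee]
    have hE : exp (ν * t) ≠ 0 := (exp_pos _).ne'
    field_simp
  calc exp (-(ν * t)) * y t ≤ exp (-(ν * t)) * (S₀⁻¹ - 1 / (2 * ν) + exp (-(ν * t)) / (2 * ν))⁻¹ :=
        mul_le_mul_of_nonneg_left hyt (exp_pos _).le
    _ = 2 * ν * S₀ / ((2 * ν - S₀) * exp (ν * t) + S₀) := htarget

/-- **THE WIENER-NORM THRESHOLD `2ν`.** If the datum has `c_1(0) > 0` and total mass `Σ_{k≤K} c_k(0) ≤ W < 2ν` for every `K`
(`‖ω₀‖_{B₀} ≤ W`), then every Galerkin partial sum obeys `Σ_{k≤K} c_k(t) ≤ (2νW/(2ν − W))·e^{−νt}` (`t ≥ 0`): a uniform,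
exponentially decaying `B₀` bound. [new here — MODEL] -/
theorem partialSum_le_of_wiener (he : IsNonnegCascade ν e) (hν : 0 < ν) (h1 : 0 < e 1 0) {W : ℝ} (hW : W < 2 * ν)
    (hdata : ∀ K, ∑ k ∈ range (K + 1), e k 0 ≤ W) (K : ℕ) (t : ℝ) (ht : 0 ≤ t) :
    ∑ k ∈ range (K + 1), e k t ≤ 2 * ν * W / (2 * ν - W) * exp (-(ν * t)) := by
  -- reduce to K ≥ 1 (the partial sums are monotone in K)
  have hmonoK : ∑ k ∈ range (K + 1), e k t ≤ ∑ k ∈ range (max K 1 + 1), e k t :=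
    sum_le_sum_of_subset_of_nonneg (range_subset_range.mpr (Nat.succ_le_succ (le_max_left K 1)))
      (fun k _ _ => he.nonneg k t ht)
  refine le_trans hmonoK ?_
  set K' := max K 1 with hK'
  have hK1 : 1 ≤ K' := le_max_right _ _
  set S₀ : ℝ := ∑ k ∈ range (K' + 1), e k 0 with hS₀
  have hS₀W : S₀ ≤ W := hdata K'
  have hS₀pos : 0 < S₀ := by
    have : e 1 0 ≤ S₀ := single_le_sum (f := fun k => e k 0) (fun k _ => he.init_nonneg k) (mem_range.mpr (by omega))
    linarith
  have hWpos : 0 < W := lt_of_lt_of_le hS₀pos hS₀W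
  have h := partialSum_le_riccati he hν h1 K' hK1 (lt_of_le_of_lt hS₀W hW) t ht
  refine le_trans h ?_
  -- 2ν S₀/((2ν − S₀)e^{νt} + S₀) ≤ 2ν S₀/((2ν − S₀) e^{νt}) ≤ 2ν W/((2ν − W) e^{νt})
  have hE : 1 ≤ exp (ν * t) := one_le_exp (by positivity)
  have hE0 : 0 < exp (ν * t) := exp_pos _
  have h2S : 0 < 2 * ν - S₀ := by linarith
  have h2W : 0 < 2 * ν - W := by linarith
  rw [show 2 * ν * W / (2 * ν - W) * exp (-(ν * t)) = 2 * ν * W / ((2 * ν - W) * exp (ν * t)) by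
    rw [exp_neg]; field_simp]
  rw [div_le_div_iff₀ (by positivity) (by positivity)]
  -- 2ν S₀ (2ν − W) e^{νt} ≤ 2ν W ((2ν − S₀) e^{νt} + S₀)
  have : S₀ * (2 * ν - W) ≤ W * (2 * ν - S₀) := by nlinarith
  nlinarith [mul_le_mul_of_nonneg_right this hE0.le, mul_nonneg (mul_nonneg (by linarith : (0:ℝ) ≤ 2 * ν) hWpos.le) hS₀pos.le]

end IsNonnegCascade

end SheetNSLineTorusCascade
end Summit.NavierStokesRegularity.OSWSelfSimilar
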